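import Summits.NavierStokesRegularity.OSWSelfSimilar.SheetRLinearisedFormBounds
import HarnessLib

/-!
# SHEET-ℝ frame, EVEN ZERO-MASS class `E⁺₀` — dictionary layer 1: parity-free and EVEN compactly supported tests, the mass
# functional, the normalised bump, the zero-mass test space, and the cutoff tests `χ_R u`, `χ_R² u` of an even profile

HONEST FRAMING (cell ns-blowup GROUP B / zone Z3, case Z3-SR-SPEC EVEN half; 1-D MODEL certificate frame (viscous gCLM/OSW sheet on the
line); not Euler/NS; «violates: none — MODEL»).  Nothing here asserts that a profile exists; no number of record moves.

The odd-class resolvent dictionary (selfsim g11/g12: `SheetRLinearisedTests` … `SheetREvansOdd`) is keyed on ODD compactly supported tests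
(`IsCompactTest`) and the odd energy space `Esp`.  The even half of Z3-SR-SPEC (`CertificateViscousSheetRSpectrumEven`, HYPOTHESIS-LEDGER
row (P5)⁺) lives in the EVEN ZERO-MASS class `E⁺₀` (DESIGN-Z3-SR-SPEC-EVEN (D1)); its identification step «`E⁺*(σ) = 0` ⇔ eigenvalue» is
PAPER for want of an even resolvent dictionary.  This file starts that dictionary:

* `IsCompactTestAny` — the PARITY-FREE part of a compactly supported energy-class test (`v = v(0) + ∫₀v₁`, `v₁ ∈ L²`, `v, v₁` vanish
  off a bounded set); every `IsCompactTest` is one (`IsCompactTest.toAny`); the analytic facts the form bounds use are parity-free: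
  continuity, boundedness, weights (`weighted_of_any`), `L¹` membership, the four test-side weights and the fixed-test bound
  `abs_linForm_le_any` (verbatim twins of `SheetRLinearisedFormBounds.testWeights` / `abs_linForm_le`);
* `IsCompactTestE` — `IsCompactTestAny` + `v` EVEN; closed under `0, +, •` ⇒ the submodules `testSpaceE` (all even tests) and
  `testSpaceE0` (even tests with ZERO MASS `∫ v = 0`);
* the mass of a test is additive (`integral_add_of_testE`), so the zero-mass tests form a submodule.
The normalised bump, the codimension-one decomposition `v − (∫v)·ρ ∈ testSpaceE0` (DEFECT-CONSTANT device of DESIGN (PO-1)), the cutoff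
tests `χ_R u`, `χ_R² u` of an even profile and the mass limits `∫χ_R u → ∫u` are in the companion file `SheetREvenTestsBump`.
Two hypothesis structures, two submodules; no named fact.  WHAT THIS IS NOT: not NS.
-/

noncomputable section

namespace Summit.NavierStokesRegularity.OSWSelfSimilar
namespace SheetREvenTests

open _root_.MeasureTheory _root_.Set _root_.Filter _root_.Real SheetRWeakProfilePV SheetRWeakToStrong SheetREnergyClass SheetRWeightedMeasure
  SheetRLinearisedTests SheetREnergySpace SheetRTestSpace SheetRLinearisedFormBounds
open scoped Topology ENNReal

/-! ### §1 Parity-free compactly supported tests -/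

/-- **Parity-free compactly supported energy-class test** `(v, v₁)`: `v = v(0) + ∫₀v₁`, `v₁ ∈ L²`, and `v`, `v₁` vanish pointwise where
`R ≤ |ξ|` for some `R`. [folklore] -/
structure IsCompactTestAny (v v₁ : ℝ → ℝ) : Prop where
  /-- primitive form `v = v(0) + ∫₀ v₁` -/
  primitive : ∀ x, v x = v 0 + ∫ s in (0 : ℝ)..x, v₁ s
  /-- `v₁ ∈ L²` -/
  memLp : MemLp v₁ 2 volume
  /-- `v` and `v₁` vanish off a bounded set -/
  support : ∃ R : ℝ, ∀ x, R ≤ |x| → v x = 0 ∧ v₁ x = 0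

/-- An odd test is a parity-free test. [folklore] -/
theorem _root_.Summit.NavierStokesRegularity.OSWSelfSimilar.SheetRLinearisedTests.IsCompactTest.toAny {v v₁ : ℝ → ℝ}
    (h : IsCompactTest v v₁) : IsCompactTestAny v v₁ :=
  ⟨h.primitive, h.memLp, h.support⟩

/-- **EVEN compactly supported energy-class test**: a parity-free test with `v` even. [folklore] -/
structure IsCompactTestE (v v₁ : ℝ → ℝ) : Prop extends IsCompactTestAny v v₁ where
  /-- `v` is even -/
  even : ∀ y, v (-y) = v y

/-- Basic facts of a parity-free test `(v, v₁)`: `v` continuous, `prim v₁ x = v x − v 0`, `|v| ≤ B`, compact support. [folklore] -/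
theorem basic_of_any {v v₁ : ℝ → ℝ} (h : IsCompactTestAny v v₁) :
    Continuous v ∧ (∀ x, prim v₁ x = v x - v 0) ∧ (∃ B : ℝ, 0 ≤ B ∧ ∀ x, |v x| ≤ B) ∧ HasCompactSupport v := by
  have hii : ∀ a b, IntervalIntegrable v₁ volume a b := intervalIntegrable_of_memLp_two h.memLp
  have hc : Continuous v := continuous_of_primitive h.primitive hii
  have hprim : ∀ x, prim v₁ x = v x - v 0 := fun x => by rw [prim_apply, h.primitive x]; ring
  obtain ⟨R, hR⟩ := h.support
  have hsupp : HasCompactSupport v := by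
    refine HasCompactSupport.intro (isCompact_Icc : IsCompact (Icc (-|R|) |R|)) fun x hx => ?_
    have : R ≤ |x| := by
      simp only [mem_Icc, not_and_or, not_le] at hx
      rcases hx with hx | hx
      · linarith [le_abs_self R, neg_abs_le x]
      · linarith [le_abs_self R, le_abs_self x]
    exact (hR x this).1
  obtain ⟨B, hB⟩ := isCompact_Icc.exists_bound_of_continuousOn (hc.continuousOn (s := Icc (-(|R| + 1)) (|R| + 1)))
  refine ⟨hc, hprim, ⟨max B 0, le_max_right _ _, fun x => ?_⟩, hsupp⟩
  by_cases hx : x ∈ Icc (-(|R| + 1)) (|R| + 1)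
  · exact ((Real.norm_eq_abs _).symm.le.trans (hB x hx)).trans (le_max_left _ _)
  · have hx' : R ≤ |x| := by
      have h1 : |R| + 1 < |x| := by
        by_contra hle
        exact hx (mem_Icc.2 (abs_le.1 (not_lt.1 hle)))
      linarith [le_abs_self R]
    rw [(hR x hx').1, abs_zero]
    exact le_max_right _ _

/-- A parity-free test is in `L²` and in `L¹`. [folklore] -/
theorem memLp_integrable_of_any {v v₁ : ℝ → ℝ} (h : IsCompactTestAny v v₁) : MemLp v 2 volume ∧ Integrable v := by
  obtain ⟨hc, -, -, hsupp⟩ := basic_of_any h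
  exact ⟨hc.memLp_of_hasCompactSupport (μ := volume) hsupp, hc.integrable_of_hasCompactSupport hsupp⟩

/-- **Weights of a parity-free test**: `∫ (L²+ξ²)v² < ∞` and `∫ (L²+ξ²)v₁² < ∞`. [folklore] -/
theorem weighted_of_any {L : ℝ} {v v₁ : ℝ → ℝ} (h : IsCompactTestAny v v₁) :
    Integrable (fun y => (L ^ 2 + y ^ 2) * v y ^ 2) ∧ Integrable (fun y => (L ^ 2 + y ^ 2) * v₁ y ^ 2) := by
  obtain ⟨hc, -, -, -⟩ := basic_of_any h
  obtain ⟨hv2, -⟩ := memLp_integrable_of_any h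
  obtain ⟨R, hR⟩ := h.support
  have hw : ∀ y : ℝ, |y| < R → L ^ 2 + y ^ 2 ≤ L ^ 2 + R ^ 2 := fun y hy => by
    have : y ^ 2 ≤ R ^ 2 := by rw [← sq_abs y]; exact pow_le_pow_left₀ (abs_nonneg _) hy.le 2
    linarith
  have hwm : AEStronglyMeasurable (fun y : ℝ => L ^ 2 + y ^ 2) volume := by fun_prop
  constructor
  · refine ((hv2.integrable_sq).const_mul (L ^ 2 + R ^ 2)).mono' (hwm.mul (hc.aestronglyMeasurable.pow 2))
      (Eventually.of_forall fun y => ?_)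
    rw [Real.norm_eq_abs, abs_of_nonneg (by positivity)]
    by_cases hy : |y| < R
    · exact mul_le_mul_of_nonneg_right (hw y hy) (sq_nonneg _)
    · rw [(hR y (not_lt.1 hy)).1]; simp
  · refine ((h.memLp.integrable_sq).const_mul (L ^ 2 + R ^ 2)).mono' (hwm.mul (h.memLp.1.pow 2))
      (Eventually.of_forall fun y => ?_)
    rw [Real.norm_eq_abs, abs_of_nonneg (by positivity)]
    by_cases hy : |y| < R
    · exact mul_le_mul_of_nonneg_right (hw y hy) (sq_nonneg _)
    · rw [(hR y (not_lt.1 hy)).2]; simp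

/-- A parity-free test pair gives two elements of `W L`. [folklore] -/
theorem memLp_W_of_any {L : ℝ} {v v₁ : ℝ → ℝ} (h : IsCompactTestAny v v₁) : MemLp v 2 (μw L) ∧ MemLp v₁ 2 (μw L) := by
  obtain ⟨hc, -, -, -⟩ := basic_of_any h
  obtain ⟨hv, hv₁⟩ := weighted_of_any (L := L) h
  exact ⟨memLp_W hc.aestronglyMeasurable hv, memLp_W h.memLp.1 hv₁⟩

/-! ### §2 The fixed-test bound, parity-free (twin of `SheetRLinearisedFormBounds`) -/

section Fixed

variable {L D₀ D₁ V₀ : ℝ} {d V : ℝ → ℝ}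

/-- **The four test-side weights are in `L²_w`** for a parity-free test. [folklore] -/
theorem testWeights_any {v v₁ : ℝ → ℝ} (hL : 0 < L) (hdm : AEStronglyMeasurable d volume) (hVm : AEStronglyMeasurable V volume)
    (hD₁ : 0 ≤ D₁) (hd : ∀ ξ, |d ξ| ≤ D₀ + D₁ * |ξ|) (hV : ∀ ξ, |V ξ| ≤ V₀) (h : IsCompactTestAny v v₁) :
    (AEStronglyMeasurable v₁ volume ∧ Integrable fun y => (L ^ 2 + y ^ 2) * v₁ y ^ 2) ∧
    (AEStronglyMeasurable (fun y => 2 * y * v y / (L ^ 2 + y ^ 2)) volume ∧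
      Integrable fun y => (L ^ 2 + y ^ 2) * (2 * y * v y / (L ^ 2 + y ^ 2)) ^ 2) ∧
    (AEStronglyMeasurable (fun y => d y * v y) volume ∧ Integrable fun y => (L ^ 2 + y ^ 2) * (d y * v y) ^ 2) ∧
    (AEStronglyMeasurable (fun y => V y * v y) volume ∧ Integrable fun y => (L ^ 2 + y ^ 2) * (V y * v y) ^ 2) := by
  obtain ⟨hc, -, ⟨B, hB0, hB⟩, -⟩ := basic_of_any h
  obtain ⟨hwv, hwv₁⟩ := weighted_of_any (L := L) h
  obtain ⟨R, hR⟩ := h.support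
  have hw : ∀ y : ℝ, 0 < L ^ 2 + y ^ 2 := fun y => by positivity
  have hwm : AEStronglyMeasurable (fun y : ℝ => L ^ 2 + y ^ 2) volume := by fun_prop
  have hvm : AEStronglyMeasurable v volume := hc.aestronglyMeasurable
  have hgc : Continuous fun y => 2 * y * v y / (L ^ 2 + y ^ 2) :=
    ((continuous_const.mul continuous_id).mul hc).div (by fun_prop) fun y => (hw y).ne'
  refine ⟨⟨h.memLp.1, hwv₁⟩, ⟨hgc.aestronglyMeasurable, ?_⟩, ⟨hdm.mul hvm, ?_⟩, ⟨hVm.mul hvm, ?_⟩⟩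
  · refine (hwv.const_mul (4 / L ^ 2)).mono' (hwm.mul (hgc.aestronglyMeasurable.pow 2)) (Eventually.of_forall fun y => ?_)
    rw [Real.norm_eq_abs, abs_of_nonneg (by positivity)]
    have hL2 : 0 < L ^ 2 := by positivity
    have hwy := hw y
    calc (L ^ 2 + y ^ 2) * (2 * y * v y / (L ^ 2 + y ^ 2)) ^ 2 = 4 * y ^ 2 * v y ^ 2 / (L ^ 2 + y ^ 2) := by
          field_simp
          ring
      _ ≤ 4 * v y ^ 2 := by
          rw [div_le_iff₀ hwy]
          nlinarith [sq_nonneg L, sq_nonneg (v y), mul_nonneg (sq_nonneg L) (sq_nonneg (v y))]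
      _ ≤ 4 / L ^ 2 * ((L ^ 2 + y ^ 2) * v y ^ 2) := by
          rw [div_mul_eq_mul_div, le_div_iff₀ hL2]
          nlinarith [sq_nonneg y, sq_nonneg (v y), mul_nonneg (sq_nonneg y) (sq_nonneg (v y))]
  · refine (hwv.const_mul ((D₀ + D₁ * |R|) ^ 2)).mono' (hwm.mul ((hdm.mul hvm).pow 2)) (Eventually.of_forall fun y => ?_)
    rw [Real.norm_eq_abs, abs_of_nonneg (by positivity)]
    by_cases hy : R ≤ |y|
    · rw [(hR y hy).1]; simp
    · have hy' : |y| < |R| := (not_le.1 hy).trans_le (le_abs_self R)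
      have hdy : |d y| ≤ D₀ + D₁ * |R| := (hd y).trans (by gcongr)
      have hdy2 : d y ^ 2 ≤ (D₀ + D₁ * |R|) ^ 2 := by
        rw [← sq_abs (d y)]; exact pow_le_pow_left₀ (abs_nonneg _) hdy 2
      calc (L ^ 2 + y ^ 2) * (d y * v y) ^ 2 = d y ^ 2 * ((L ^ 2 + y ^ 2) * v y ^ 2) := by ring
        _ ≤ (D₀ + D₁ * |R|) ^ 2 * ((L ^ 2 + y ^ 2) * v y ^ 2) :=
            mul_le_mul_of_nonneg_right hdy2 (by positivity)
  · refine (hwv.const_mul (V₀ ^ 2)).mono' (hwm.mul ((hVm.mul hvm).pow 2)) (Eventually.of_forall fun y => ?_)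
    rw [Real.norm_eq_abs, abs_of_nonneg (by positivity)]
    have hV2 : V y ^ 2 ≤ V₀ ^ 2 := by rw [← sq_abs (V y)]; exact pow_le_pow_left₀ (abs_nonneg _) (hV y) 2
    calc (L ^ 2 + y ^ 2) * (V y * v y) ^ 2 = V y ^ 2 * ((L ^ 2 + y ^ 2) * v y ^ 2) := by ring
      _ ≤ V₀ ^ 2 * ((L ^ 2 + y ^ 2) * v y ^ 2) := mul_le_mul_of_nonneg_right hV2 (by positivity)

/-- **Integrability and the fixed-test bound, parity-free.** For `u, u₁` a.e.-strongly measurable with `∫wu² < ∞`, `∫wu₁² < ∞` and a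
parity-free test `(v, v₁)`: the `linForm` integrand is integrable and
`|linForm L d V u u₁ v v₁| ≤ √(∫wu₁²)·(√∫wv₁² + √∫w(2ξv/w)² + √∫w(dv)²) + √(∫wu²)·√∫w(Vv)²`. [folklore] -/
theorem abs_linForm_le_any {u u₁ v v₁ : ℝ → ℝ} (hL : 0 < L) (hdm : AEStronglyMeasurable d volume)
    (hVm : AEStronglyMeasurable V volume) (hD₁ : 0 ≤ D₁) (hd : ∀ ξ, |d ξ| ≤ D₀ + D₁ * |ξ|) (hV : ∀ ξ, |V ξ| ≤ V₀)
    (h : IsCompactTestAny v v₁) (hum : AEStronglyMeasurable u volume) (hu₁m : AEStronglyMeasurable u₁ volume)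
    (h0 : Integrable fun y => (L ^ 2 + y ^ 2) * u y ^ 2) (h1 : Integrable fun y => (L ^ 2 + y ^ 2) * u₁ y ^ 2) :
    Integrable (fun y => (L ^ 2 + y ^ 2) * (u₁ y * v₁ y) + 2 * y * (u₁ y * v y) + (L ^ 2 + y ^ 2) * d y * (u₁ y * v y)
        + (L ^ 2 + y ^ 2) * V y * (u y * v y)) ∧
    |linForm L d V u u₁ v v₁| ≤
      Real.sqrt (∫ y, (L ^ 2 + y ^ 2) * u₁ y ^ 2) *
          (Real.sqrt (∫ y, (L ^ 2 + y ^ 2) * v₁ y ^ 2) + Real.sqrt (∫ y, (L ^ 2 + y ^ 2) * (2 * y * v y / (L ^ 2 + y ^ 2)) ^ 2)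
            + Real.sqrt (∫ y, (L ^ 2 + y ^ 2) * (d y * v y) ^ 2)) +
        Real.sqrt (∫ y, (L ^ 2 + y ^ 2) * u y ^ 2) * Real.sqrt (∫ y, (L ^ 2 + y ^ 2) * (V y * v y) ^ 2) := by
  obtain ⟨⟨hv₁m, hwv₁⟩, ⟨hgm, hwg⟩, ⟨hdvm, hwdv⟩, ⟨hVvm, hwVv⟩⟩ := testWeights_any hL hdm hVm hD₁ hd hV h
  have hwm : AEStronglyMeasurable (fun y : ℝ => L ^ 2 + y ^ 2) volume := by fun_prop
  obtain ⟨i1, b1⟩ := integral_weight_abs_mul_le (L := L) hu₁m hv₁m h1 hwv₁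
  obtain ⟨i2, b2⟩ := integral_weight_abs_mul_le (L := L) hu₁m hgm h1 hwg
  obtain ⟨i3, b3⟩ := integral_weight_abs_mul_le (L := L) hu₁m hdvm h1 hwdv
  obtain ⟨i4, b4⟩ := integral_weight_abs_mul_le (L := L) hum hVvm h0 hwVv
  have key : ∀ {f g : ℝ → ℝ}, AEStronglyMeasurable f volume → AEStronglyMeasurable g volume →
      Integrable (fun y => (L ^ 2 + y ^ 2) * |f y * g y|) → Integrable (fun y => (L ^ 2 + y ^ 2) * (f y * g y)) := by
    intro f g hf hg hi
    refine hi.mono' (hwm.mul (hf.mul hg)) (Eventually.of_forall fun y => ?_)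
    rw [Real.norm_eq_abs, abs_mul, abs_of_nonneg (by positivity : (0:ℝ) ≤ L ^ 2 + y ^ 2)]
  have j1 := key hu₁m hv₁m i1
  have j2 := key hu₁m hgm i2
  have j3 := key hu₁m hdvm i3
  have j4 := key hum hVvm i4
  have hsum : Integrable (fun y => (L ^ 2 + y ^ 2) * (u₁ y * v₁ y) + (L ^ 2 + y ^ 2) * (u₁ y * (2 * y * v y / (L ^ 2 + y ^ 2)))
      + (L ^ 2 + y ^ 2) * (u₁ y * (d y * v y)) + (L ^ 2 + y ^ 2) * (u y * (V y * v y))) := ((j1.add j2).add j3).add j4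
  have heq : (fun y => (L ^ 2 + y ^ 2) * (u₁ y * v₁ y) + 2 * y * (u₁ y * v y) + (L ^ 2 + y ^ 2) * d y * (u₁ y * v y)
      + (L ^ 2 + y ^ 2) * V y * (u y * v y)) =
      fun y => (L ^ 2 + y ^ 2) * (u₁ y * v₁ y) + (L ^ 2 + y ^ 2) * (u₁ y * (2 * y * v y / (L ^ 2 + y ^ 2)))
      + (L ^ 2 + y ^ 2) * (u₁ y * (d y * v y)) + (L ^ 2 + y ^ 2) * (u y * (V y * v y)) :=
    funext fun y => integrand_eq L hL d V u u₁ v v₁ y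
  refine ⟨by rw [heq]; exact hsum, ?_⟩
  have habs : ∀ {f g : ℝ → ℝ}, Integrable (fun y => (L ^ 2 + y ^ 2) * (f y * g y)) →
      Integrable (fun y => (L ^ 2 + y ^ 2) * |f y * g y|) →
      |∫ y, (L ^ 2 + y ^ 2) * (f y * g y)| ≤ ∫ y, (L ^ 2 + y ^ 2) * |f y * g y| := by
    intro f g hi hi'
    calc |∫ y, (L ^ 2 + y ^ 2) * (f y * g y)| ≤ ∫ y, |(L ^ 2 + y ^ 2) * (f y * g y)| := by
          rw [← Real.norm_eq_abs]; exact (norm_integral_le_integral_norm _).trans (le_of_eq (by simp only [Real.norm_eq_abs]))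
      _ = ∫ y, (L ^ 2 + y ^ 2) * |f y * g y| := by
          refine integral_congr_ae (Eventually.of_forall fun y => ?_)
          show |(L ^ 2 + y ^ 2) * (f y * g y)| = (L ^ 2 + y ^ 2) * |f y * g y|
          rw [abs_mul, abs_of_nonneg (by positivity : (0:ℝ) ≤ L ^ 2 + y ^ 2)]
  have h12 : Integrable (fun y => (L ^ 2 + y ^ 2) * (u₁ y * v₁ y) + (L ^ 2 + y ^ 2) * (u₁ y * (2 * y * v y / (L ^ 2 + y ^ 2)))) :=
    j1.add j2
  have h123 : Integrable (fun y => (L ^ 2 + y ^ 2) * (u₁ y * v₁ y) + (L ^ 2 + y ^ 2) * (u₁ y * (2 * y * v y / (L ^ 2 + y ^ 2)))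
      + (L ^ 2 + y ^ 2) * (u₁ y * (d y * v y))) := h12.add j3
  unfold linForm
  rw [heq, integral_add h123 j4, integral_add h12 j3, integral_add j1 j2]
  have e1 := (habs j1 i1).trans b1
  have e2 := (habs j2 i2).trans b2
  have e3 := (habs j3 i3).trans b3
  have e4 := (habs j4 i4).trans b4
  calc |(((∫ y, (L ^ 2 + y ^ 2) * (u₁ y * v₁ y)) + ∫ y, (L ^ 2 + y ^ 2) * (u₁ y * (2 * y * v y / (L ^ 2 + y ^ 2))))
        + ∫ y, (L ^ 2 + y ^ 2) * (u₁ y * (d y * v y))) + ∫ y, (L ^ 2 + y ^ 2) * (u y * (V y * v y))|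
      ≤ ((|∫ y, (L ^ 2 + y ^ 2) * (u₁ y * v₁ y)| + |∫ y, (L ^ 2 + y ^ 2) * (u₁ y * (2 * y * v y / (L ^ 2 + y ^ 2)))|)
        + |∫ y, (L ^ 2 + y ^ 2) * (u₁ y * (d y * v y))|) + |∫ y, (L ^ 2 + y ^ 2) * (u y * (V y * v y))| :=
        (abs_add_le _ _).trans (add_le_add ((abs_add_le _ _).trans (add_le_add (abs_add_le _ _) le_rfl)) le_rfl)
    _ ≤ _ := by nlinarith [e1, e2, e3, e4]

end Fixed

/-! ### §3 Closure properties; the even test spaces; the mass -/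

/-- The zero pair is an even test. [folklore] -/
theorem isCompactTestE_zero : IsCompactTestE (0 : ℝ → ℝ) (0 : ℝ → ℝ) :=
  ⟨⟨fun x => by simp, MemLp.zero, ⟨0, fun x _ => by simp⟩⟩, fun y => by simp⟩

/-- Even tests are closed under addition. [folklore] -/
theorem isCompactTestE_add {v v₁ v' v₁' : ℝ → ℝ} (h : IsCompactTestE v v₁) (h' : IsCompactTestE v' v₁') :
    IsCompactTestE (v + v') (v₁ + v₁') := by
  refine ⟨⟨fun x => ?_, h.memLp.add h'.memLp, ?_⟩, fun y => ?_⟩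
  · simp only [Pi.add_apply]
    rw [intervalIntegral.integral_add (intervalIntegrable_of_memLp_two h.memLp 0 x) (intervalIntegrable_of_memLp_two h'.memLp 0 x)]
    have h1 := h.primitive x
    have h2 := h'.primitive x
    linarith
  · obtain ⟨R, hR⟩ := h.support
    obtain ⟨R', hR'⟩ := h'.support
    refine ⟨max R R', fun x hx => ?_⟩
    obtain ⟨h1, h2⟩ := hR x ((le_max_left _ _).trans hx)
    obtain ⟨h1', h2'⟩ := hR' x ((le_max_right _ _).trans hx)
    simp [h1, h2, h1', h2']
  · simp only [Pi.add_apply, h.even, h'.even]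

/-- Even tests are closed under scalar multiplication. [folklore] -/
theorem isCompactTestE_smul {v v₁ : ℝ → ℝ} (c : ℝ) (h : IsCompactTestE v v₁) : IsCompactTestE (c • v) (c • v₁) := by
  refine ⟨⟨fun x => ?_, h.memLp.const_smul c, ?_⟩, fun y => ?_⟩
  · simp only [Pi.smul_apply, smul_eq_mul]
    rw [intervalIntegral.integral_const_mul]
    have h1 := h.primitive x
    rw [h1]
    ring
  · obtain ⟨R, hR⟩ := h.support
    refine ⟨R, fun x hx => ?_⟩
    obtain ⟨h1, h2⟩ := hR x hx
    simp [h1, h2]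
  · simp only [Pi.smul_apply, smul_eq_mul, h.even]

/-- **The even test space** (compactly supported even energy-class tests) as a submodule of `(ℝ → ℝ) × (ℝ → ℝ)`. [folklore] -/
def testSpaceE : Submodule ℝ ((ℝ → ℝ) × (ℝ → ℝ)) where
  carrier := {vp | IsCompactTestE vp.1 vp.2}
  add_mem' := fun {_ _} ha hb => isCompactTestE_add ha hb
  zero_mem' := isCompactTestE_zero
  smul_mem' := fun c {_} ha => isCompactTestE_smul c ha

/-- Membership in `testSpaceE`. [folklore] -/
theorem mem_testSpaceE_iff (vp : (ℝ → ℝ) × (ℝ → ℝ)) : vp ∈ testSpaceE ↔ IsCompactTestE vp.1 vp.2 := Iff.rfl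

/-- The mass is additive on even tests: `∫ (v + v') = ∫ v + ∫ v'`. [folklore] -/
theorem integral_add_of_testE {v v₁ v' v₁' : ℝ → ℝ} (h : IsCompactTestE v v₁) (h' : IsCompactTestE v' v₁') :
    ∫ y, (v + v') y = (∫ y, v y) + ∫ y, v' y := by
  simp only [Pi.add_apply]
  exact integral_add (memLp_integrable_of_any h.toIsCompactTestAny).2 (memLp_integrable_of_any h'.toIsCompactTestAny).2

/-- **The even ZERO-MASS test space** `testSpaceE0 = {(v, v₁) even test : ∫ v = 0}`. [folklore] -/
def testSpaceE0 : Submodule ℝ ((ℝ → ℝ) × (ℝ → ℝ)) where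
  carrier := {vp | IsCompactTestE vp.1 vp.2 ∧ ∫ y, vp.1 y = 0}
  add_mem' := by
    rintro a b ⟨ha, ha0⟩ ⟨hb, hb0⟩
    refine ⟨isCompactTestE_add ha hb, ?_⟩
    rw [Prod.fst_add, integral_add_of_testE ha hb, ha0, hb0, add_zero]
  zero_mem' := ⟨isCompactTestE_zero, by simp⟩
  smul_mem' := by
    rintro c a ⟨ha, ha0⟩
    refine ⟨isCompactTestE_smul c ha, ?_⟩
    rw [Prod.smul_fst]
    simp only [Pi.smul_apply, smul_eq_mul]
    rw [integral_const_mul, ha0, mul_zero]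

/-- Membership in `testSpaceE0`. [folklore] -/
theorem mem_testSpaceE0_iff (vp : (ℝ → ℝ) × (ℝ → ℝ)) : vp ∈ testSpaceE0 ↔ IsCompactTestE vp.1 vp.2 ∧ ∫ y, vp.1 y = 0 := Iff.rfl

/-- `testSpaceE0 ≤ testSpaceE`. [folklore] -/
theorem testSpaceE0_le : testSpaceE0 ≤ testSpaceE := fun _ h => h.1

end SheetREvenTests
end Summit.NavierStokesRegularity.OSWSelfSimilar

end
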